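import Summits.QuantumFields.YangMills.Theorems.LuscherReductionDressedRitzPolyakovLiftDressed
import Summits.QuantumFields.YangMills.Theorems.LuscherReductionDressedRitzLiftLeakageAllBases
import HarnessLib

/-!
# Route `LuscherReduction`, item `DressedRitz` (stmt-QuantumFields-20205), line «polyakovlift» r3 — dressed twin T1 (owner g25 supplement):
# the TIME-DRESSED lift is linear in the one-site function

Support module (LEAD prover ym-lead-20205-polyakovlift g0; `--supports stmt-QuantumFields-20205`, helper).  Owner word (W1·g25) listed the five
`liftVec`∕`liftFamily`-keyed tree declarations that need a DRESSED TWIN under skeleton r3 (11209be61e7d2ff5); T1 is the linearity of the lift in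
the one-site function, used by s1's all-bases reduction (T2 `LiftLeak.residualLaw_allBases_of_reference`):

* `iterate_transferApply_sum_smul` — `K_β^[m](Σ_n c_n • ψ_n) = Σ_n c_n • K_β^[m]ψ_n` for physical `ψ_n` (via the tree's linear `transferOp` on the
  physical subspace, `VacDict.coe_iterate_transferOp`, `LinearMap.pow_apply`);
* ★ `dressedLiftVec_sum_smul` — `dressedLiftVec β φ (Σ_n c_n f_n) = Σ_n c_n • dressedLiftVec β φ f_n` (s1's `LiftLeak.liftVec_sum_smul` + the above).

HONEST FRAMING: fixed-lattice linear algebra on the conditional femto rung R2b1; nothing here bears on infinite volume, the continuum limit or the Clay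
gap.  References: M. Lüscher, U. Wolff, NPB 339 (1990) 222 [cite: LuscherWolff1990].
-/

set_option autoImplicit false

noncomputable section

open MeasureTheory Filter Topology Real
open Literature.MathematicalPhysics.QuantumFieldTheory (GaugeConfig Site gaugeTransform)
open scoped BigOperators

namespace Summit.QuantumFields.YangMills.Theorems.FemtoTransferGap.PolyakovLift

open Summit.QuantumFields.YangMills.Theorems.FemtoTransferGap

section Linear

variable {L : ℕ} [NeZero L]

/-- `K_β^[m]` is linear on finite combinations of physical functions: `K_β^[m](Σ_n c_n • ψ_n) = Σ_n c_n • K_β^[m]ψ_n`. [folklore] -/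
theorem iterate_transferApply_sum_smul (β : ℝ) (m : ℕ) {N : ℕ} {ψ : Fin N → (GaugeConfig 3 L SU2 → ℝ)} (hψ : ∀ n, IsPhys (ψ n))
    (c : Fin N → ℝ) :
    (transferApply (L := L) β)^[m] (∑ n, c n • ψ n) = ∑ n, c n • (transferApply (L := L) β)^[m] (ψ n) := by
  set X : Fin N → physSubmodule L := fun n => ⟨ψ n, hψ n⟩ with hX
  have h1 : (∑ n, c n • ψ n) = ((∑ n, c n • X n : physSubmodule L) : GaugeConfig 3 L SU2 → ℝ) := by
    simp only [hX, Submodule.coe_sum, Submodule.coe_smul]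
  have h2 : (⇑(transferOp (L := L) β))^[m] (∑ n, c n • X n) = ∑ n, c n • (⇑(transferOp (L := L) β))^[m] (X n) := by
    simp only [← Module.End.pow_apply, map_sum, map_smul]
  rw [h1, ← VacDict.coe_iterate_transferOp, h2, Submodule.coe_sum]
  refine Finset.sum_congr rfl fun n _ => ?_
  rw [Submodule.coe_smul, VacDict.coe_iterate_transferOp]

/-- ★ **T1 — the dressed lift is linear in the one-site function**: `dressedLiftVec β φ (Σ_n c_n f_n) = Σ_n c_n • dressedLiftVec β φ f_n` for physical
`φ`, `f_n`. [cite: LuscherWolff1990] -/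
theorem dressedLiftVec_sum_smul (β : ℝ) {φ : GaugeConfig 3 L SU2 → ℝ} (hφ : IsPhys φ) {N : ℕ}
    {f : Fin N → (GaugeConfig 3 1 SU2 → ℝ)} (hf : ∀ n, IsPhys (f n)) (c : Fin N → ℝ) :
    dressedLiftVec β φ (fun V => ∑ n, c n * f n V) = ∑ n, c n • dressedLiftVec β φ (f n) := by
  unfold dressedLiftVec
  rw [LiftLeak.liftVec_sum_smul β hφ hf c]
  exact iterate_transferApply_sum_smul β _ (fun n => isPhys_liftVec β hφ (hf n)) c

end Linear

end Summit.QuantumFields.YangMills.Theorems.FemtoTransferGap.PolyakovLift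

end
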